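import Summits.BirchSwinnertonDyer.BirchSwinnertonDyer.Theorems.EisensteinPrimesAnalyticLambdaAbsoluteCount
import Summits.BirchSwinnertonDyer.Rank1Residual.X1.RankOneParitySqueezeLeaf
import HarnessLib

/-!
# Route `EisensteinPrimes` (line `mudescent`, cruxes 3/5) × row A1: THEOREM B′'s value congruence with
# `Σ s_ℓ = 1` on the RANK-ONE LEAF gives Mazur's main conjecture AND `BSD(E,p)` through route P₁
# (`X1.RankOne.Leaf.mazurMainConjecture_and_bsdp_of_muZero_lamOne`; helper; ONE THEOREM)

Seat `bsd-eis-lam-a` g10 (PROGRAMME PART 1b, ACCEL-LIST (4): ANALYTIC side of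
`stub_lambdaCount_offLocus`; items stmt-BirchSwinnertonDyer-19033 / -19035; owner bsd-eis-ky). No
definition, no named fact, nothing about any particular curve; closes nothing; moves no label.

WHAT AND WHY (HOME/lam-a-g10/lam-a-MEMO-10.md §5). THEOREM B′ (MEMO-10 §2: MEMO-9's THEOREM B with the
prime-level unit re-sourced to Mazur 1977 III Cor. (8.5), every odd `p`) delivers, at a type-A étale end
`W` of squarefree conductor whose `E[p]` is ramified at exactly one prime `q` with `p ∣ num((q−1)/12)`,
`p` not a `p`-th power mod `q`, `rank_{ℤ_p} T_𝔓 = 1` (+ Yoo's hypothesis at `p = 3`), the value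
congruence `G_W ≡ c·U·∏_{ℓ∈S}(1 − γ_ℓ) (mod p)` with `U ∈ Λˣ` (`= 𝓛_q`) and `S` the split multiplicative
primes `∉ {p, q}` — hence `μ_an(W) = 0 ∧ λ_an(W) = Σ_{ℓ∈S} s_ℓ` by the predecessor's socket
`X1.analyticMuLE_zero_and_analyticLambdaEq_sum_sFactor_of_valueCongr` (p546280 §4). On the RANK-ONE
LEAF of X1 (row A1 of the ladder: good anomalous type A, `r = 1`) the b2b door
`X1.RankOne.Leaf.mazurMainConjecture_and_bsdp_of_muZero_lamOne` turns `μ_an = 0 ∧ λ_an = 1` into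
MAZUR'S MAIN CONJECTURE ∧ `BSD(E,p)` from PUBLISHED named facts only (Wuthrich Thm. 16, Perrin-Riou–
Schneider, Perrin-Riou 1987, Mazur–Tate sigma, modularity, GZK) — Schneider's non-degeneracy being a
CONSEQUENCE of `λ_an = 1`. This file is the composition: when `Σ_{ℓ∈S} s_ℓ = 1` (exactly one split
`ℓ ∉ {p, q}`, with `p ∤ f_ℓ`), THEOREM B′'s congruence gives MC ∧ `BSD(E,p)` at the pair with NO
per-pair analytic reading. Census of record (MEMO-10 §5, work/census/bearing.tsv): 135 row-A1 cells at
`p = 3` and 10 at `p = 5` (`N < 5·10⁵`) are family members with `Σ s_ℓ = 1` — there the cell's per-pair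
two-engine certificate is replaced by a theorem on paper + this kernel composition.

HONEST FRAMING. The congruence (`hval`) is what MEMO-10 THEOREM B′ PROVES ON PAPER (modulo Mazur 1977
II (16.6)/(18.10), III (8.1)/(8.5), Merel 1996 / Lecouturier 2021, Ribet 1990 Prop. 1, Vatsal 2005
Thm. 1.1, Ohta 2014 (3.6.2) / Yoo 2023 Thm. 1.4); it is NOT asserted here. The six named facts are the
door's, PUBLISHED, taken as hypotheses exactly as the door does (conditional-result shape of record).

References: [Mazur1977] III Cor. (8.5); [Wuthrich2014] Thm. 16; [BalakrishnanMullerStein2015] Thm. 1.7;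
[PerrinRiou1987] §1.4 Cor. 1.8; [GreenbergVatsal2000] §1 (9), §2 Prop. (2.4); MEMO-10 §2, §5.
-/

set_option linter.dupNamespace false
set_option autoImplicit false

noncomputable section

open scoped Classical MatrixGroups ModularForm

open PowerSeries CongruenceSubgroup WeierstrassCurve NumberField IsDedekindDomain
  Literature.NumberTheory.EllipticCurves
  Literature.NumberTheory.EllipticCurves.ModularForms
  Literature.NumberTheory.EllipticCurves.Rank1Residual
  Literature.NumberTheory.EllipticCurves.GreenbergVatsal2000
  Literature.NumberTheory.EllipticCurves.Greenberg1999
  Summit.BirchSwinnertonDyer.Rank1Residual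
  Summit.BirchSwinnertonDyer.Rank1Residual.X1.MuLambda
  Summit.BirchSwinnertonDyer.Rank1Residual.X1.MuPart
  Summit.BirchSwinnertonDyer.Rank1Residual.X1.ParitySqueeze
  Summit.BirchSwinnertonDyer.Rank1Residual.X1.RankOneParitySqueeze
  Summit.BirchSwinnertonDyer.Rank1Residual.X11a
  Summit.BirchSwinnertonDyer.Rank1Residual.Iwasawa
  Summit.BirchSwinnertonDyer.BirchSwinnertonDyer.Theorems
  Summit.BirchSwinnertonDyer.BirchSwinnertonDyer.Theorems.Rank1ResidualX1Defs
  Summit.BirchSwinnertonDyer.BirchSwinnertonDyer.Theorems.EisensteinPrimesAnalyticLambdaAbsoluteCount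

namespace Summit.BirchSwinnertonDyer.BirchSwinnertonDyer.Theorems.EisensteinPrimesAnalyticLambdaAbsoluteCountRouteP

variable {p : ℕ} [hp : Fact p.Prime]
  {W : WeierstrassCurve ℚ} [W.IsElliptic] [W.IsGloballyMinimal] [NeZero (W.conductorNorm ℤ)]
  {f : CuspForm (Gamma0 (W.conductorNorm ℤ)) 2} {ϖ : ℚ}

/-- **Route P₁ fed by THEOREM B′: Mazur's main conjecture ∧ `BSD(E,p)` at a rank-one leaf pair of the
twin family with exactly one unit of raising `λ`.** On the rank-one leaf `X1.RankOne.Leaf W p` (row A1: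
good anomalous type A, `ord_{s=1} L(E,s) = 1`), granted the door's PUBLISHED facts Wuthrich 2014
Thm. 16 (`hW16`), Perrin-Riou–Schneider at odd `p` (`hS`), Perrin-Riou 1987 (`hPR`), the Mazur–Tate
sigma function (`hMT`), modularity (`hmod`), Gross–Zagier–Kolyvagin (`hGZK`): ONE datum `(f, ϖ, G)`
(`ι(G) = ϖ·L_p(f, α)`), a unit `U ∈ Λˣ` (Mazur's cuspidal unit `𝓛_q`), a finite set `S` of integers
`> 1` prime to `p` with `Σ_{ℓ∈S} s_ℓ = 1` (the split multiplicative primes `∉ {p, q}`: exactly one, with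
`p ∤ f_ℓ`), one unit `c ∈ ℤ_p` and THEOREM B′'s value congruence `‖(G − C(c)·U·∏_{ℓ∈S}(1−γ_ℓ))(ζ−1)‖
≤ 1/p` at all primitive `p^{m+1}`-th roots of unity, `m ≥ n₀` ⟹ `MazurMainConjecture W p ∧ BSDp W p`.
No `p`-adic height, no descent, no `#Ш_an`, no per-pair `λ`-reading enters.
[cite: Mazur1977, III Cor. (8.5)] [cite: Wuthrich2014, Thm. 16 (p. 393)]
[cite: BalakrishnanMullerStein2015, Thm. 1.7] [cite: PerrinRiou1987, §1.4 Cor. 1.8]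
[cite: GreenbergVatsal2000, §1 (9), §2 Prop. (2.4)] -/
theorem X1.RankOne.Leaf.mazurMainConjecture_and_bsdp_of_valueCongr_unit_of_sum_sFactor_eq_one
    (hW16 : Wuthrich2014.charIdeal_dvd_padicLFunction) (hS : Schneider1985_order_charGenerator_odd)
    (hPR : perrinRiou_rankOne_leadingTerms_odd) (hMT : mazur_tate_sigma_exists_odd)
    (hmod : nonempty_modularParametrizationData) (hGZK : rank_eq_analyticRank_of_analyticRank_le_one)
    (hL : X1.RankOne.Leaf W p)
    (hf : IsNewformOf W f) (hϖ : (ϖ : ℝ) * W.realPeriodRat = plusPeriod f) {G : IwasawaAlgebra p}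
    (hG : iwasawaToPowerSeries p G =
      PowerSeries.C (ϖ : ℚ_[p]) * padicLFunction f (unitRoot W p : ℚ_[p]))
    {U : IwasawaAlgebra p} (hU : IsUnit U) (S : Finset ℕ) (hS' : ∀ ℓ ∈ S, p.Coprime ℓ ∧ 1 < ℓ)
    (hS1 : ∑ ℓ ∈ S, sFactor p ℓ = 1) {c : ℤ_[p]} (hc : IsUnit c) {n₀ : ℕ}
    (hval : ∀ m : ℕ, n₀ ≤ m → ∀ ζ : ℂ_[p], IsPrimitiveRoot ζ (p ^ (m + 1)) →
      ‖∑' k, ((algebraMap ℚ_[p] ℂ_[p]).comp (algebraMap ℤ_[p] ℚ_[p]))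
          (PowerSeries.coeff k (G - PowerSeries.C c * (U * ∏ ℓ ∈ S, (1 - frobeniusSeries p ℓ)))) *
            (ζ - 1) ^ k‖ ≤ (p : ℝ)⁻¹) :
    MazurMainConjecture W p ∧ BSDp W p := by
  have hX := isClassX1_of_classX1 hL.1
  obtain ⟨hμ0, hlam⟩ :=
    EisensteinPrimesAnalyticLambdaAbsoluteCount.X1.analyticMuLE_zero_and_analyticLambdaEq_sum_sFactor_of_valueCongr
      hX.two_ne hf hϖ hG hU S hS' hc hval
  rw [hS1] at hlam
  exact hL.mazurMainConjecture_and_bsdp_of_muZero_lamOne hW16 hS hPR hMT hmod hGZK hμ0 hlam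

end Summit.BirchSwinnertonDyer.BirchSwinnertonDyer.Theorems.EisensteinPrimesAnalyticLambdaAbsoluteCountRouteP

end
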